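import Summits.HodgeConjecture.HodgeConjecture.Theses.AdelicCoherence

/-!
# Route AdelicCoherence — `CoherenceGlue` (glue item stmt-HodgeConjecture-14448)

`FrobeniusPlanes → CoherentClassesAlgebraic → DeRhamPlanes → ClassicalPeriodData → (Hodge models) →
HodgeConjectureNumberFields`: for `X` smooth projective over a number field `k ↪ ℂ`, take the period
realization `P` of `ClassicalPeriodData`; its bridge reduces the Hodge conjecture for `X_ℂ` to
`P.B`-Hodge classes being `P.B`-algebraic, which `CoherentClassesAlgebraic` gives on the de Rham planes
of `DeRhamPlanes`, whose Frobenius condition is `FrobeniusPlanes`.  This is the inner part of the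
route's deciding theorem `closes`, verbatim.  Pure logic over the route file; no other import, no
named-fact hypothesis, no sorry.
-/

-- `Summit.HodgeConjecture.HodgeConjecture.Theorems` is the mandated namespace (single-problem
-- summit: Problem = Summit), which `linter.dupNamespace` flags on every declaration; the lakefile
-- turns the linter off tree-wide (weak option), restated here so stand-alone elaboration is
-- warning-free too.
set_option linter.dupNamespace false

namespace Summit.HodgeConjecture.HodgeConjecture.Theorems

/-- **Item stmt-HodgeConjecture-14448 (`CoherenceGlue`), route `AdelicCoherence`**: the body of the
route's `closes` below its ℚ̄-descent / number-field reduction steps. [cite: Ogus1982, §4] -/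
theorem adelicCoherence_coherenceGlue_proof :
    Summit.HodgeConjecture.HodgeConjecture.Theses.AdelicCoherence.CoherenceGlue := by
  intro hF hC hD hP hM k _ _ ρ n X hX hXρ
  obtain ⟨P, ⟨hI, hII, hL⟩, hbr, -⟩ := hP k
  refine hbr hXρ (hM n _ hXρ) (fun p ↦ ?_)
  refine (P.B.hodgeConjectureFor_iff hXρ p).2 ?_
  intro β hβ
  obtain ⟨W, hW₁, hW₂⟩ := hD ρ P hI hII hL hX hXρ p
  exact hC ρ P hI hII hL hX hXρ p W hW₁
    (fun v hv Φ w hw ↦ hF ρ P hI hII hL hX hXρ p v hv Φ w (hW₁ w hw)) β hβ (hW₂ β hβ)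

end Summit.HodgeConjecture.HodgeConjecture.Theorems
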